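import Summits.QuantumFields.BalabanUV.T4Continuum.Support.NE3LinearisedAverageSup
import HarnessLib

/-!
# Support | NE7 (gen 95, brick (S2)-B1 of memo WEIGHT-CURRENCY-DEAD §7): THE ℓ¹ LETTER OF THE STRAIGHT DOUBLE-BAR TOWER, k-FREE —
# `dirL1 (QbarIter L (j+1) W Y) (periodBox N) ≤ (L∕L^d)^{j+1}·(1 + 3·K·curvSum)·dirL1 Y (periodBox (N·L^{j+1}))`, `K = (L^d∕L)·d·(2·nbRad+1)^d`

Cell `pub-balaban`, rung (B)+1 sub-cell t4, lineage `b2b-balaban-t4-ne7-p1` (CRUX PROVER NE7 #1 = OWNER of row NE7), generation 95.  Over leaf-10's ONE-STEP ℓ¹ letter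
`BlockAverageDbarLinNorms.sum_period_norm_dbarLin_le` (localised directions are CONTRACTED by `L^{1−d} + O(a)` per step) and the Π-C-1 tower bookkeeping of
`NE3LinearisedAverageSup` (`curv`, `curvSum`, `step_small`), exactly as the sup letter `norm_QbarIter_le_sup'` iterates `norm_Qbar_le_sup`.

WHY.  The honest per-pair binder of the NE7 record (`hdecomp`, F326∕F327, END `NE7HintOfSliceNormalisationSU2Dec`) needs the DIRECT ℓ¹ letter of the linearised average of
the fibre element, `dirL1(D X) ≤ q₁‖X‖_w²` (memo §7 (S2)); by the telescope `D X = −Σ_j D^{(k−j)}E_j` and the structure `dirIter = QbarIter + gaugeDir∘framePotW`, its straight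
part is pushed to the top by the ℓ¹ norm of the PARTIAL double-bar towers — this file: k-free, with the natural contraction `(L∕L^d)^{m}` of an `m`-fold average in `ℓ¹`.
WHAT ([folklore]; 0 def, 0 sorry).  §1 `dirL1_Qbar_le` (one step on the torus: `dirL1 (Qbar L W Y) (periodBox M) ≤ (L∕L^d + K′·curv d L a)·dirL1 Y (periodBox (L·M))`,
`K′ = d(2nbRad+1)^d`, for `W` unitary of plaquette radius `a` with `512(d+1)(d+4)L²a ≤ 1` and `Y` `(L·M)`-periodic).  §2 **`dirL1_QbarIter_le'`** (the tower in product
form under the summed line `((L^d∕L)·K′)·curvSum d L (j+1) x ≤ 2∕3`) and **`dirL1_QbarIter_le`** (`≤ 3·(L∕L^d)^{j+1}·dirL1 Y`), `dirL1_QbarIter_le_of_le` (every `m ≤ j+1`).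
HONEST FRAMING (page 1): lattice kinematics of the linearised averaging map on OUR frame; nothing of Bałaban's asserted; the frame part, the remainder letters and `hdecomp` are NOT
here; NE7 NOT PROVED; spine 0∕9; finite T⁴ rung (B)+1 — NOT infinite volume, NOT mass gap, NOT `BetaPertH`, NOT Clay.  Continuum YM on T⁴ ⇐ BetaPertH ∧ nine spine estimates
(0/9 proved); BetaPertH ⇐ (D1) ∧ (D4) ∧ CAP+tail; G-an2-4 gates asym, D1 and NE2/3/4.
-/

set_option autoImplicit false

open scoped BigOperators Matrix.Norms.L2Operator
open Finset

namespace Summit.QuantumFields.BalabanUV.T4Continuum.NE7QbarIterL1Letter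

open Literature.MathematicalPhysics.QuantumFieldTheory.Balaban1983to89
open B7Prop1Explicit B7Prop2Explicit
open T4AveragingDeficitWall (IsUnitaryCfg IsSkewDir SmallField dirL1)
open T4AveragingDeficitWallBoundary (IsPeriodicCfg periodBox)
open AveragingDeficitPeriodicCounting (IsPeriodicDir)
open AveragingDeficitChartCalculus (cavg)
open AveragingDeficitTwoLevelPrep (twoLevelSmall prop1Radius)
open AveragingDeficitMultiLevelPrep (cavgIter radIter tower LevelSmall natCast_tower_succ)
open AveragingDeficitFermat (isPeriodicCfg_cavg)
open AveragingDeficitDerivCore (dirL1_nonneg)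
open BlockAverageVaryHolo (nbRad)
open BlockAverageDbarLinNorms (sum_period_norm_dbarLin_le)
open NE3TangentCovariantStructure (Qbar Qbar_add_period)
open NE3TangentCovariantTower (QbarIter QbarIter_succ QbarIter_zero QbarIter_one step_small)
open NE3FramePotBoundW (levelSmall_of_le)
open NE3LinearisedAverageSup (curv curvSum curv_nonneg curvSum_nonneg curvSum_succ curvSum_mono norm_Wcx_sub_one_le_w)

noncomputable section
variable {d : ℕ} {n : Type*} [Fintype n] [DecidableEq n]

/-! ## §1 One step in `ℓ¹` on the torus -/

/-- **ONE STEP OF THE DOUBLE-BAR AVERAGE IN `ℓ¹`**: for `W` unitary of plaquette radius `a`, `512(d+1)(d+4)L²a ≤ 1`, and an `(L·M)`-periodic `Y`,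
`dirL1 (Qbar L W Y) (periodBox M) ≤ (L∕L^d + d(2nbRad+1)^d·curv d L a)·dirL1 Y (periodBox (L·M))` (leaf-10's `sum_period_norm_dbarLin_le` read through
`Qbar L W Y y κ = dbarLin L W Y (L•y) κ`). [folklore] -/
theorem dirL1_Qbar_le [Nonempty n] {L M : ℕ} (hL : 1 ≤ L) (hM : 1 ≤ M) {W : Site d → Fin d → (Matrix n n ℂ)ˣ} (hWu : IsUnitaryCfg W)
    {a : ℝ} (ha : 0 ≤ a) (hsmall : 512 * (d + 1) * (d + 4) * (L : ℝ) ^ 2 * a ≤ 1) (hWa : SmallField W a)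
    {Y : Site d → Fin d → Matrix n n ℂ} (hY : IsPeriodicDir Y ((L : ℤ) * M)) :
    dirL1 (Qbar L W Y) (periodBox (d := d) M) ≤ ((L : ℝ) / (L : ℝ) ^ d + (d * (2 * nbRad d L + 1) ^ d) * curv d L a) * dirL1 Y (periodBox (d := d) (L * M)) := by
  have hw0 : 0 ≤ 16 * ((d : ℝ) + 1) * ((d : ℝ) + 4) * (L : ℝ) ^ 2 * a := by positivity
  have hw : 16 * ((d : ℝ) + 1) * ((d : ℝ) + 4) * (L : ℝ) ^ 2 * a ≤ 1 / 32 := by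
    have h0 : 0 ≤ ((d : ℝ) + 1) * ((d : ℝ) + 4) * (L : ℝ) ^ 2 * a := by positivity
    nlinarith
  have h := sum_period_norm_dbarLin_le hL hM hWu hw0 hw (fun q κ r => norm_Wcx_sub_one_le_w hL hWu ha hsmall hWa q κ r) Y hY
  have e : dirL1 (Qbar L W Y) (periodBox (d := d) M) = ∑ y ∈ periodBox (d := d) M, ∑ κ : Fin d, ‖BlockAveragePushDirSplit.dbarLin L W Y ((L : ℤ) • y) κ‖ := rfl
  rw [e]
  refine h.trans (le_of_eq ?_)
  unfold curv
  ring

/-! ## §2 The straight double-bar tower in `ℓ¹` -/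

/-- **THE DOUBLE-BAR TOWER IN `ℓ¹`, PRODUCT FORM** (tower class: `W` unitary `(tower L N (j+1))`-periodic, `0 ≤ x`, `LevelSmall d L j x`, `SmallField W x`;
`Y` `(tower L N (j+1))`-periodic; the summed line `((L^d∕L)·d(2nbRad+1)^d)·curvSum d L (j+1) x ≤ 2∕3`):
`dirL1 (QbarIter L (j+1) W Y) (periodBox N) ≤ (L∕L^d)^{j+1}·(1 + 3·((L^d∕L)·d(2nbRad+1)^d)·curvSum d L (j+1) x)·dirL1 Y (periodBox (tower L N (j+1)))`. [folklore] -/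
theorem dirL1_QbarIter_le' [Nonempty n] {L N : ℕ} (hL : 1 ≤ L) (hN : 1 ≤ N) :
    ∀ (j : ℕ) {W : Site d → Fin d → (Matrix n n ℂ)ˣ} {x : ℝ}, IsUnitaryCfg W → IsPeriodicCfg W ((tower L N (j + 1) : ℕ) : ℤ) → 0 ≤ x →
    LevelSmall d L j x → SmallField W x →
    ∀ {Y : Site d → Fin d → (Matrix n n ℂ)}, IsPeriodicDir Y ((tower L N (j + 1) : ℕ) : ℤ) →
    ((L : ℝ) ^ d / L * (d * (2 * nbRad d L + 1) ^ d)) * curvSum d L (j + 1) x ≤ 2 / 3 →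
      dirL1 (QbarIter L (j + 1) W Y) (periodBox (d := d) N)
        ≤ ((L : ℝ) / (L : ℝ) ^ d) ^ (j + 1) * (1 + 3 * (((L : ℝ) ^ d / L * (d * (2 * nbRad d L + 1) ^ d)) * curvSum d L (j + 1) x))
          * dirL1 Y (periodBox (d := d) (tower L N (j + 1))) := by
  intro j
  induction j with
  | zero =>
      intro W x hWu hWP hx hsm hWx Y hYP hA
      have hL0 : (0 : ℝ) < L := by exact_mod_cast (by omega : 0 < L)
      obtain ⟨h512, -, -, -⟩ := step_small hL hWu hx hsm.two hWx
      have hYP' : IsPeriodicDir Y ((L : ℤ) * N) := by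
        have e : ((tower L N (0 + 1) : ℕ) : ℤ) = (L : ℤ) * N := by rw [natCast_tower_succ]; rfl
        rw [← e]; exact hYP
      have h := dirL1_Qbar_le hL hN hWu hx h512 hWx hYP'
      rw [QbarIter_one]
      have hcs : curvSum d L (0 + 1) x = curv d L x := by unfold curvSum; simp [radIter]
      rw [hcs]
      have hc0 := curv_nonneg (d := d) L hx
      have hD0 : 0 ≤ dirL1 Y (periodBox (d := d) (tower L N (0 + 1))) := dirL1_nonneg _ _
      have eT : periodBox (d := d) (L * N) = periodBox (d := d) (tower L N (0 + 1)) := rfl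
      rw [eT] at h
      refine h.trans (mul_le_mul_of_nonneg_right ?_ hD0)
      have hK0 : 0 ≤ (L : ℝ) ^ d / L * (d * (2 * nbRad d L + 1) ^ d) := by positivity
      have e1 : ((L : ℝ) / (L : ℝ) ^ d) ^ (0 + 1) * (1 + 3 * ((L : ℝ) ^ d / L * (d * (2 * nbRad d L + 1) ^ d) * curv d L x))
          = (L : ℝ) / (L : ℝ) ^ d + 3 * ((d * (2 * nbRad d L + 1) ^ d) * curv d L x) := by
        rw [zero_add, pow_one]; field_simp
      rw [e1]
      nlinarith [mul_nonneg (show (0:ℝ) ≤ d * (2 * nbRad d L + 1) ^ d by positivity) hc0]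
  | succ j ih =>
      intro W x hWu hWP hx hsm hWx Y hYP hA
      have hL0 : (0 : ℝ) < L := by exact_mod_cast (by omega : 0 < L)
      obtain ⟨h512, hU', hx', hS'⟩ := step_small hL hWu hx hsm.1 hWx
      -- periods one level up
      have hWP1 : IsPeriodicCfg W ((L : ℤ) * ((tower L N (j + 1) : ℕ) : ℤ)) := by rw [← natCast_tower_succ]; exact hWP
      have hYP1 : IsPeriodicDir Y ((L : ℤ) * ((tower L N (j + 1) : ℕ) : ℤ)) := by rw [← natCast_tower_succ]; exact hYP
      have hWP' : IsPeriodicCfg (cavg L W) ((tower L N (j + 1) : ℕ) : ℤ) := isPeriodicCfg_cavg L _ hWP1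
      have hYP' : IsPeriodicDir (Qbar L W Y) ((tower L N (j + 1) : ℕ) : ℤ) := fun z i κ => Qbar_add_period L hWP1 hYP1 z i κ
      -- one step in ℓ¹ at the bottom
      have hT1 : 1 ≤ tower L N (j + 1) := Nat.one_le_iff_ne_zero.mpr (by
        haveI : NeZero L := ⟨by omega⟩; haveI : NeZero N := ⟨by omega⟩
        exact AveragingDeficitMultiLevelPrep.tower_ne_zero L N (j + 1))
      have h1 := dirL1_Qbar_le hL hT1 hWu hx h512 hWx hYP1
      have eT : periodBox (d := d) (L * tower L N (j + 1)) = periodBox (d := d) (tower L N (j + 1 + 1)) := rfl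
      rw [eT] at h1
      -- the remaining tower at the averaged background
      have hA' : (L : ℝ) ^ d / L * (d * (2 * nbRad d L + 1) ^ d) * curvSum d L (j + 1) (prop1Radius d L x) ≤ 2 / 3 := by
        have hK0 : 0 ≤ (L : ℝ) ^ d / L * (d * (2 * nbRad d L + 1) ^ d) := by positivity
        rw [curvSum_succ] at hA
        nlinarith [curv_nonneg (d := d) L hx, curvSum_nonneg (d := d) L (j + 1) hx']
      have h := ih hU' hWP' hx' hsm.2 hS' hYP' hA'
      rw [QbarIter_succ]
      refine h.trans ?_
      rw [curvSum_succ L (j + 1) x]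
      set K : ℝ := (L : ℝ) ^ d / L * (d * (2 * nbRad d L + 1) ^ d) with hKdef
      set A' := curvSum d L (j + 1) (prop1Radius d L x) with hA'def
      set c := curv d L x with hcdef
      have hK0 : 0 ≤ K := by positivity
      have hc0 : 0 ≤ c := curv_nonneg (d := d) L hx
      have hA'0 : 0 ≤ A' := curvSum_nonneg L (j + 1) hx'
      have hB' : 3 * (K * A') ≤ 2 := by linarith
      have hD0 : 0 ≤ dirL1 Y (periodBox (d := d) (tower L N (j + 1 + 1))) := dirL1_nonneg _ _
      have hq0 : 0 ≤ ((L : ℝ) / (L : ℝ) ^ d) ^ (j + 1) := by positivity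
      -- `(1 + 3KA')·(L/L^d + K' c) ≤ (L/L^d)·(1 + 3K(c + A'))`, `K' = K·L/L^d`
      have key : (1 + 3 * (K * A')) * ((L : ℝ) / (L : ℝ) ^ d + (d * (2 * nbRad d L + 1) ^ d) * c)
          ≤ ((L : ℝ) / (L : ℝ) ^ d) * (1 + 3 * (K * (c + A'))) := by
        have eK : (d * (2 * nbRad d L + 1) ^ d : ℝ) = ((L : ℝ) / (L : ℝ) ^ d) * K := by
          rw [hKdef]; field_simp
        rw [eK]
        have hLd : 0 ≤ (L : ℝ) / (L : ℝ) ^ d := by positivity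
        have e1 : (1 + 3 * (K * A')) * ((L : ℝ) / (L : ℝ) ^ d + (L : ℝ) / (L : ℝ) ^ d * K * c)
            = ((L : ℝ) / (L : ℝ) ^ d) * (1 + 3 * (K * A') + K * c + 3 * (K * A') * (K * c)) := by ring
        have e2 : ((L : ℝ) / (L : ℝ) ^ d) * (1 + 3 * (K * (c + A'))) = ((L : ℝ) / (L : ℝ) ^ d) * (1 + 3 * (K * A') + 3 * (K * c)) := by ring
        rw [e1, e2]
        refine mul_le_mul_of_nonneg_left ?_ hLd
        nlinarith [mul_nonneg hK0 hc0]
      have hfac : 0 ≤ ((L : ℝ) / (L : ℝ) ^ d) ^ (j + 1) * (1 + 3 * (K * A')) := by positivity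
      calc ((L : ℝ) / (L : ℝ) ^ d) ^ (j + 1) * (1 + 3 * (K * A')) * dirL1 (Qbar L W Y) (periodBox (d := d) (tower L N (j + 1)))
          ≤ ((L : ℝ) / (L : ℝ) ^ d) ^ (j + 1) * (1 + 3 * (K * A')) * (((L : ℝ) / (L : ℝ) ^ d + (d * (2 * nbRad d L + 1) ^ d) * c)
              * dirL1 Y (periodBox (d := d) (tower L N (j + 1 + 1)))) := mul_le_mul_of_nonneg_left h1 hfac
        _ = ((L : ℝ) / (L : ℝ) ^ d) ^ (j + 1) * ((1 + 3 * (K * A')) * ((L : ℝ) / (L : ℝ) ^ d + (d * (2 * nbRad d L + 1) ^ d) * c))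
              * dirL1 Y (periodBox (d := d) (tower L N (j + 1 + 1))) := by ring
        _ ≤ ((L : ℝ) / (L : ℝ) ^ d) ^ (j + 1) * (((L : ℝ) / (L : ℝ) ^ d) * (1 + 3 * (K * (c + A'))))
              * dirL1 Y (periodBox (d := d) (tower L N (j + 1 + 1))) :=
            mul_le_mul_of_nonneg_right (mul_le_mul_of_nonneg_left key hq0) hD0
        _ = ((L : ℝ) / (L : ℝ) ^ d) ^ (j + 1 + 1) * (1 + 3 * (K * (c + A'))) * dirL1 Y (periodBox (d := d) (tower L N (j + 1 + 1))) := by ring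

/-- **THE DOUBLE-BAR TOWER IN `ℓ¹`**: under the summed line, `dirL1 (QbarIter L (j+1) W Y) (periodBox N) ≤ 3·(L∕L^d)^{j+1}·dirL1 Y (periodBox (tower L N (j+1)))` —
an `m`-fold average CONTRACTS ℓ¹ by `(L∕L^d)^m` up to the k-free factor `3`. [folklore] -/
theorem dirL1_QbarIter_le [Nonempty n] {L N : ℕ} (hL : 1 ≤ L) (hN : 1 ≤ N) (j : ℕ) {W : Site d → Fin d → (Matrix n n ℂ)ˣ} {x : ℝ}
    (hWu : IsUnitaryCfg W) (hWP : IsPeriodicCfg W ((tower L N (j + 1) : ℕ) : ℤ)) (hx : 0 ≤ x) (hsm : LevelSmall d L j x) (hWx : SmallField W x)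
    {Y : Site d → Fin d → (Matrix n n ℂ)} (hYP : IsPeriodicDir Y ((tower L N (j + 1) : ℕ) : ℤ))
    (hA : ((L : ℝ) ^ d / L * (d * (2 * nbRad d L + 1) ^ d)) * curvSum d L (j + 1) x ≤ 2 / 3) :
    dirL1 (QbarIter L (j + 1) W Y) (periodBox (d := d) N) ≤ 3 * ((L : ℝ) / (L : ℝ) ^ d) ^ (j + 1) * dirL1 Y (periodBox (d := d) (tower L N (j + 1))) := by
  have h := dirL1_QbarIter_le' hL hN j hWu hWP hx hsm hWx hYP hA
  refine h.trans ?_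
  have hp : 0 ≤ ((L : ℝ) / (L : ℝ) ^ d) ^ (j + 1) := by positivity
  have hD0 : 0 ≤ dirL1 Y (periodBox (d := d) (tower L N (j + 1))) := dirL1_nonneg _ _
  have hB : 1 + 3 * ((L : ℝ) ^ d / L * (d * (2 * nbRad d L + 1) ^ d) * curvSum d L (j + 1) x) ≤ 3 := by linarith
  calc ((L : ℝ) / (L : ℝ) ^ d) ^ (j + 1) * (1 + 3 * ((L : ℝ) ^ d / L * (d * (2 * nbRad d L + 1) ^ d) * curvSum d L (j + 1) x))
          * dirL1 Y (periodBox (d := d) (tower L N (j + 1)))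
      ≤ ((L : ℝ) / (L : ℝ) ^ d) ^ (j + 1) * 3 * dirL1 Y (periodBox (d := d) (tower L N (j + 1))) :=
        mul_le_mul_of_nonneg_right (mul_le_mul_of_nonneg_left hB hp) hD0
    _ = 3 * ((L : ℝ) / (L : ℝ) ^ d) ^ (j + 1) * dirL1 Y (periodBox (d := d) (tower L N (j + 1))) := by ring

/-- The level-`m` double-bar field in `ℓ¹`, for every `m ≤ j + 1` (the case `m = 0` is `Y` itself): `dirL1 (QbarIter L m W Y) (periodBox (tower L N (j+1−m)))
≤ 3·(L∕L^d)^m·dirL1 Y (periodBox (tower L N (j+1)))`. [folklore] -/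
theorem dirL1_QbarIter_le_of_le [Nonempty n] {L N : ℕ} (hL : 1 ≤ L) (hN : 1 ≤ N) {j : ℕ} {W : Site d → Fin d → (Matrix n n ℂ)ˣ} {x : ℝ}
    (hWu : IsUnitaryCfg W) (hWP : IsPeriodicCfg W ((tower L N (j + 1) : ℕ) : ℤ)) (hx : 0 ≤ x) (hsm : LevelSmall d L j x) (hWx : SmallField W x)
    {Y : Site d → Fin d → (Matrix n n ℂ)} (hYP : IsPeriodicDir Y ((tower L N (j + 1) : ℕ) : ℤ))
    (hA : ((L : ℝ) ^ d / L * (d * (2 * nbRad d L + 1) ^ d)) * curvSum d L (j + 1) x ≤ 2 / 3) {m : ℕ} (hm : m ≤ j + 1) :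
    dirL1 (QbarIter L m W Y) (periodBox (d := d) (tower L N (j + 1 - m))) ≤ 3 * ((L : ℝ) / (L : ℝ) ^ d) ^ m * dirL1 Y (periodBox (d := d) (tower L N (j + 1))) := by
  rcases m with _ | m
  · rw [QbarIter_zero, pow_zero, mul_one, Nat.sub_zero]
    have hD0 : 0 ≤ dirL1 Y (periodBox (d := d) (tower L N (j + 1))) := dirL1_nonneg _ _
    linarith
  · have hsm' : LevelSmall d L m x := levelSmall_of_le (by omega) hsm
    have hK0 : 0 ≤ (L : ℝ) ^ d / L * (d * (2 * nbRad d L + 1) ^ d) := by positivity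
    have hA' : ((L : ℝ) ^ d / L * (d * (2 * nbRad d L + 1) ^ d)) * curvSum d L (m + 1) x ≤ 2 / 3 :=
      (mul_le_mul_of_nonneg_left (curvSum_mono L hm hx) hK0).trans hA
    -- the tower of `j+1` levels over `N` is the tower of `m+1` levels over `tower L N (j+1-(m+1))`
    have eT : tower L N (j + 1) = tower L (tower L N (j + 1 - (m + 1))) (m + 1) := by
      have : ∀ a b : ℕ, tower L N (a + b) = tower L (tower L N a) b := by
        intro a b; induction b with
        | zero => rfl
        | succ b ih => show L * tower L N (a + b) = L * tower L (tower L N a) b; rw [ih]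
      rw [← this]; congr 1; omega
    have hN' : 1 ≤ tower L N (j + 1 - (m + 1)) := Nat.one_le_iff_ne_zero.mpr (by
      haveI : NeZero L := ⟨by omega⟩; haveI : NeZero N := ⟨by omega⟩
      exact AveragingDeficitMultiLevelPrep.tower_ne_zero L N _)
    rw [eT] at hWP hYP ⊢
    exact dirL1_QbarIter_le hL hN' m hWu hWP hx hsm' hWx hYP hA'

end

end Summit.QuantumFields.BalabanUV.T4Continuum.NE7QbarIterL1Letter
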